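import Mathlib
import HarnessLib
import Summits.NavierStokesRegularity.NavierStokesRegularity.Theorems.UnthreadedDoorAntidynamoSingleDegreeRungOdd

/-!
# Route `UnthreadedDoor` / `ThreadingFlux`, crux `PoloidalLiouville` (stmt-NavierStokesRegularity-1222), antidynamo v2 skeleton
# (sha16 `4ebf5683127b`): POINT-REFLECTION PARITY — (A) the symmetry-class Liouville theorem behind the odd rung, (B) the parity
# reduction for the EVEN-degree rung

Support file (seat leafhand-ns-unthreadeddoor-1 g1, cell decomp-ns), `--supports stmt-NavierStokesRegularity-1222 --as helper`; theorems only.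
`σ` denotes the point reflection `w ↦ c − w` (centre `c/2`; for the rung `c = x₀ + x₀`).

(A) `constant_of_curl_reflect_odd` / `constant_of_reflect_even` — **a bounded ancient mild solution (duality class, jointly smooth,
measurable slices) whose vorticity is ODD (equivalently: whose velocity is EVEN) under the point reflection about one fixed centre at all
times is slice-wise constant.**  This is the exact content of the odd-degree rung (`…SingleDegreeRungOdd`) with the single-degree
structure stripped off: even velocity ⇒ transport and stretching are even, `∂ₜω − Δω` odd ⇒ the vorticity is a bounded ancient
caloric field ⇒ constant (tree `PDE.heat_liouville`) ⇒ an odd constant is zero ⇒ `constantOfIrrotational`.  (Even velocity is NOT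
propagated by Navier–Stokes — the preserved symmetry is odd velocity — so this is an overdetermined class, and the theorem says it is
trivial inside the KNSS class; no claim beyond that.)

(B) The EVEN-degree rung (`l = 2, 4, …`, the part NOT closed by `singleDegreeRung_odd`).  There the solid harmonic is even, `Λ = ∇P × id`
even, the vorticity EVEN about `x₀` (`curl_reflect_of_even`); the velocity is then odd up to the constant `2 v(t, x₀)`
(`reflect_eq_of_curl_even`), and the parity splitting of the vorticity equation yields exactly ONE new identity, the vanishing of the
drift of the vorticity along the centre velocity: `Dω(t, x)[v(t, x₀)] = 0` for all `x` (`fderiv_vorticity_centre_eq_zero_of_even`,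
packaged under the rung's hypotheses as `singleDegreeRung_even_parity`).  The full nonlinear term survives for even `l` (it contains the
axisymmetric `l = 2` content of KNSS 2009 Thm 5.2), so this is a REDUCTION, not a proof, of the even rung.

HONEST LABEL: nothing here proves the rung for even `l`, the wall `stub_scalarLiouville`, `PoloidalLiouville` (1222), or bears on
Navier–Stokes regularity; no summit statement is proved. [folklore]
-/

noncomputable section

-- the summit and its single sub-problem share the name (CONVENTIONS §1)
set_option linter.dupNamespace false

open scoped Topology InnerProductSpace RealInnerProductSpace ContDiff Laplacian
open Filter Set Function Metric MeasureTheory MvPolynomial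
open Literature.Analysis.FluidPDE

namespace Summit.NavierStokesRegularity.NavierStokesRegularity.Theorems.PoloidalLiouville.Antidynamo

/-! ### (A) The point-reflection Liouville theorem -/

/-- **ODD VORTICITY ABOUT A FIXED CENTRE ⇒ TRIVIAL.**  A bounded ancient mild solution (`ν = 1`, duality class) with measurable slices,
jointly smooth on `(−∞,0) × ℝ³`, whose vorticity satisfies `curl (v t) (c − x) = −curl (v t) x` for one fixed `c` and all `t < 0`, `x`,
is slice-wise constant (`reflect_eq_of_curl_odd` ⇒ `timeDerivWithin_vorticity_eq_laplacian_of_even` ⇒ `curl_eq_zero_of_odd_caloric` ⇒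
`constantOfIrrotational`). [folklore] -/
theorem constant_of_curl_reflect_odd
    (v : ℝ → EuclideanSpace ℝ (Fin 3) → EuclideanSpace ℝ (Fin 3)) (c : EuclideanSpace ℝ (Fin 3))
    (hB : Literature.Analysis.FluidPDE.IsBoundedAncientMildSolution 1 v)
    (hm : ∀ t < 0, AEStronglyMeasurable (v t) volume)
    (hsm : ContDiffOn ℝ (⊤ : ℕ∞) (Function.uncurry v) (Set.Iio 0 ×ˢ Set.univ))
    (hodd : ∀ t < 0, ∀ x, curl (v t) (c - x) = -curl (v t) x) :
    ∀ t < 0, ∃ b : EuclideanSpace ℝ (Fin 3), ∀ x, v t x = b := by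
  have hsm' : IsSmoothSpaceTimeOn (Iio 0) v := hsm
  obtain ⟨M, hM⟩ := hB.isBoundedOn
  have heven : ∀ t < 0, ∀ y, v t (c - y) = v t y := by
    intro t ht
    have hvt : ContDiff ℝ ∞ (v t) := hsm'.contDiff_slice ht
    have hv2 : ContDiff ℝ 2 (v t) := hvt.of_le (by norm_cast)
    have hv1 : ContDiff ℝ 1 (v t) := hvt.of_le (by norm_cast)
    have hdiv : VectorCalculus.IsDivFree (v t) := (hB.isAncientMildSolution.1 t ht).isDivFree_of_contDiff hv1
    exact reflect_eq_of_curl_odd hv2 hdiv (fun y => hM t ht y) c (hodd t ht)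
  obtain ⟨hV, K, hK⟩ := PoloidalLiouville.vorticityOfClass v hB hm hsm
  have hheat : ∀ t < 0, ∀ x, timeDerivWithin (Iio 0) (vorticity v) t x = (Δ (vorticity v t)) x :=
    fun t ht x => timeDerivWithin_vorticity_eq_laplacian_of_even hV c heven hodd ht x
  exact PoloidalLiouville.constantOfIrrotational v hB hsm (curl_eq_zero_of_odd_caloric hV hK c hodd hheat)

/-- **EVEN VELOCITY ABOUT A FIXED CENTRE ⇒ TRIVIAL** (the same theorem phrased on the velocity: `v t (c − x) = v t x` for all `t < 0`,
`x` forces an odd vorticity, `curl (v(c − ·)) = −(curl v)(c − ·)`). [folklore] -/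
theorem constant_of_reflect_even
    (v : ℝ → EuclideanSpace ℝ (Fin 3) → EuclideanSpace ℝ (Fin 3)) (c : EuclideanSpace ℝ (Fin 3))
    (hB : Literature.Analysis.FluidPDE.IsBoundedAncientMildSolution 1 v)
    (hm : ∀ t < 0, AEStronglyMeasurable (v t) volume)
    (hsm : ContDiffOn ℝ (⊤ : ℕ∞) (Function.uncurry v) (Set.Iio 0 ×ˢ Set.univ))
    (heven : ∀ t < 0, ∀ x, v t (c - x) = v t x) :
    ∀ t < 0, ∃ b : EuclideanSpace ℝ (Fin 3), ∀ x, v t x = b := by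
  refine constant_of_curl_reflect_odd v c hB hm hsm fun t ht x => ?_
  have hvfun : (fun w => v t (c - w)) = v t := funext fun w => heven t ht w
  have h := curl_comp_const_sub (v t) c (c - x)
  rw [hvfun, sub_sub_cancel] at h
  exact h

/-! ### (B) Parity reduction for EVEN vorticity (the even-degree rung) -/

/-- **Even curl ⇒ velocity odd up to a constant.**  A bounded divergence-free `C²` field on `ℝ³` whose curl is EVEN under
`w ↦ c − w` satisfies `V(c − y) + V(y) = const` (`V + V(c − ·)` is curl-free, divergence-free, bounded ⇒ constant). [folklore] -/
theorem reflect_eq_of_curl_even {V : EuclideanSpace ℝ (Fin 3) → EuclideanSpace ℝ (Fin 3)} (hV : ContDiff ℝ 2 V)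
    (hdiv : VectorCalculus.IsDivFree V) {M : ℝ} (hM : ∀ x, ‖V x‖ ≤ M) (c : EuclideanSpace ℝ (Fin 3))
    (hev : ∀ y, curl V (c - y) = curl V y) : ∀ y y', V (c - y) + V y = V (c - y') + V y' := by
  set W : EuclideanSpace ℝ (Fin 3) → EuclideanSpace ℝ (Fin 3) := fun y => V (c - y) + V y with hW
  have hVσ : ContDiff ℝ 2 (fun y => V (c - y)) := hV.comp (contDiff_const.sub contDiff_id)
  have hW2 : ContDiff ℝ 2 W := hVσ.add hV
  have hcurl : ∀ y, curl W y = 0 := by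
    intro y
    have h1 : DifferentiableAt ℝ V y := (hV.differentiable (by norm_num)).differentiableAt
    have h2 : DifferentiableAt ℝ (fun w => V (c - w)) y := (hVσ.differentiable (by norm_num)).differentiableAt
    rw [hW, curl_add h2 h1, curl_comp_const_sub, hev y, neg_add_cancel]
  have hWdiv : VectorCalculus.IsDivFree W := by
    intro y
    have h1 : DifferentiableAt ℝ V y := (hV.differentiable (by norm_num)).differentiableAt
    have h2 : DifferentiableAt ℝ (fun w => V (c - w)) y := (hVσ.differentiable (by norm_num)).differentiableAt
    have : fderiv ℝ W y = fderiv ℝ (fun w => V (c - w)) y + fderiv ℝ V y := by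
      rw [hW]; exact fderiv_add h2 h1
    have hd1 : VectorCalculus.divergence V y = 0 := hdiv y
    have hd3 : VectorCalculus.divergence V (c - y) = 0 := hdiv (c - y)
    have hd2 := divergence_comp_const_sub V c y
    simp only [VectorCalculus.divergence] at hd1 hd2 hd3 ⊢
    rw [this, ContinuousLinearMap.toLinearMap_add, map_add, hd2, hd1, hd3, neg_zero, add_zero]
  have hWb : ∀ y, ‖W y‖ ≤ M + M := fun y =>
    (norm_add_le _ _).trans (add_le_add (hM (c - y)) (hM y))
  intro y y'
  exact eq_of_curl_eq_zero_of_isDivFree_of_bounded hW2 hcurl hWdiv hWb y y'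

/-- **PARITY SPLITTING FOR EVEN VORTICITY: the drift of the vorticity along the reflection constant vanishes.**  Let `v` solve the
vorticity formulation classically on `(−∞,0)`, with `v s (c − y) = k s − v s y` (velocity odd up to the constant `k s`) and
`curl (v s) (c − y) = curl (v s) y` (even vorticity) for all `s < 0`.  Then `Dω(t, x)[k t] = 0`: transport at `c − x` is transport at
`x` minus `Dω(x)[k]`, every other term of the vorticity equation is even. [folklore] -/
theorem fderiv_vorticity_apply_eq_zero_of_curl_even
    {v : ℝ → EuclideanSpace ℝ (Fin 3) → EuclideanSpace ℝ (Fin 3)} (hV : IsVorticitySolutionOn (Iio 0) 1 v)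
    (c : EuclideanSpace ℝ (Fin 3)) (k : ℝ → EuclideanSpace ℝ (Fin 3))
    (hrefl : ∀ s < 0, ∀ y, v s (c - y) = k s - v s y) (hev : ∀ s < 0, ∀ y, curl (v s) (c - y) = curl (v s) y)
    {t : ℝ} (ht : t < 0) (x : EuclideanSpace ℝ (Fin 3)) :
    fderiv ℝ (vorticity v t) x (k t) = 0 := by
  have E1 := hV.vorticity_eq t ht x
  have E2 := hV.vorticity_eq t ht (c - x)
  -- (a) the time derivative is even
  have ha : timeDerivWithin (Iio 0) (vorticity v) t (c - x) = timeDerivWithin (Iio 0) (vorticity v) t x := by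
    rw [timeDerivWithin_apply, timeDerivWithin_apply]
    exact derivWithin_congr (fun s hs => by simp only [vorticity_apply]; exact hev s hs x)
      (by simp only [vorticity_apply]; exact hev t ht x)
  -- (b) spatial derivatives: `Dω(c − x) = −Dω(x)`, `Dv(c − x) = Dv(x)`
  have hωfun : (fun w => vorticity v t (c - w)) = vorticity v t := by
    funext w; simp only [vorticity_apply]; exact hev t ht w
  have hvfun : (fun w => v t (c - w)) = fun w => k t - v t w := funext fun w => hrefl t ht w
  have hb1 : fderiv ℝ (vorticity v t) (c - x) = -fderiv ℝ (vorticity v t) x := by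
    have h := fderiv_comp_const_sub (vorticity v t) c x
    rw [hωfun] at h
    rw [h, neg_neg]
  have hb2 : fderiv ℝ (v t) (c - x) = fderiv ℝ (v t) x := by
    have h := fderiv_comp_const_sub (v t) c x
    rw [hvfun, fderiv_const_sub] at h
    exact (neg_injective h).symm
  have hconv1 : convect (v t) (vorticity v t) (c - x) =
      convect (v t) (vorticity v t) x - fderiv ℝ (vorticity v t) x (k t) := by
    simp only [convect, hb1, hrefl t ht x, _root_.neg_apply, map_sub]
    abel
  have hconv2 : convect (vorticity v t) (v t) (c - x) = convect (vorticity v t) (v t) x := by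
    have hω : vorticity v t (c - x) = vorticity v t x := by rw [vorticity_apply]; exact hev t ht x
    simp only [convect, hb2, hω]
  -- (c) the Laplacian is even
  have hc : (Δ (vorticity v t)) (c - x) = (Δ (vorticity v t)) x := by
    have h := laplacian_comp_const_sub (vorticity v t) c x
    rw [hωfun] at h
    exact h.symm
  rw [ha, hconv1, hconv2, hc] at E2
  -- E1 : T + A = B + L ;  E2 : T + (A - D) = B + L
  have : timeDerivWithin (Iio 0) (vorticity v) t x + (convect (v t) (vorticity v t) x - fderiv ℝ (vorticity v t) x (k t)) =
      timeDerivWithin (Iio 0) (vorticity v) t x + convect (v t) (vorticity v t) x := by rw [E2, E1]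
  have h2 : fderiv ℝ (vorticity v t) x (k t) =
      (timeDerivWithin (Iio 0) (vorticity v) t x + convect (v t) (vorticity v t) x) -
      (timeDerivWithin (Iio 0) (vorticity v) t x + (convect (v t) (vorticity v t) x - fderiv ℝ (vorticity v t) x (k t))) := by
    abel
  rw [h2, this, sub_self]

/-- A homogeneous polynomial of EVEN degree is an even function: `P(−y) = P(y)`. [folklore] -/
theorem evalPoly_neg_of_even {P : MvPolynomial (Fin 3) ℝ} {l : ℕ} (hP : P.IsHomogeneous l) (hl : Even l)
    (y : EuclideanSpace ℝ (Fin 3)) :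
    eval (fun i => (-y) i) P = eval (fun i => y i) P := by
  have h := evalPoly_smul hP (-1) y
  rw [neg_one_smul] at h
  rw [h, hl.neg_one_pow, one_mul]

/-- … so its gradient is odd: `∇P(−y) = −∇P(y)`. [folklore] -/
theorem gradient_evalPoly_neg_of_even {P : MvPolynomial (Fin 3) ℝ} {l : ℕ} (hP : P.IsHomogeneous l) (hl : Even l)
    (y : EuclideanSpace ℝ (Fin 3)) :
    gradient (fun z : EuclideanSpace ℝ (Fin 3) => eval (fun i => z i) P) (-y) =
      -gradient (fun z : EuclideanSpace ℝ (Fin 3) => eval (fun i => z i) P) y := by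
  set Q : EuclideanSpace ℝ (Fin 3) → ℝ := fun z => eval (fun i => z i) P with hQ
  have hfun : (fun w => Q (0 - w)) = Q := by
    funext w
    rw [zero_sub]
    exact evalPoly_neg_of_even hP hl w
  have h1 : fderiv ℝ (fun w => Q (0 - w)) y = -fderiv ℝ Q (0 - y) := fderiv_comp_const_sub Q 0 y
  rw [hfun, zero_sub] at h1
  have h2 : fderiv ℝ Q (-y) = -fderiv ℝ Q y := by rw [h1, neg_neg]
  rw [gradient, gradient, h2, map_neg]

/-- … and the toroidal profile `Λ = ∇P × id` is even: `Λ(−y) = Λ(y)`. [folklore] -/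
theorem crossGradient_neg_of_even {P : MvPolynomial (Fin 3) ℝ} {l : ℕ} (hP : P.IsHomogeneous l) (hl : Even l)
    (y : EuclideanSpace ℝ (Fin 3)) :
    cross (gradient (fun z : EuclideanSpace ℝ (Fin 3) => eval (fun i => z i) P) (-y)) (-y) =
      cross (gradient (fun z : EuclideanSpace ℝ (Fin 3) => eval (fun i => z i) P) y) y := by
  rw [gradient_evalPoly_neg_of_even hP hl y, ← crossCLM_apply, map_neg, map_neg]
  simp [crossCLM_apply]

/-- **EVEN VORTICITY.**  Under the hypotheses of the rung with a non-zero profile `P` of EVEN degree `l ≥ 2`, every slice has a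
vorticity that is even under the point reflection about the centre: `curl (v t) (x₀ + x₀ − x) = curl (v t) x` (off the centre by step
S2 and the evenness of `Λ`; at the centre trivially). [folklore] -/
theorem curl_reflect_of_even
    (v : ℝ → EuclideanSpace ℝ (Fin 3) → EuclideanSpace ℝ (Fin 3)) (x₀ : EuclideanSpace ℝ (Fin 3))
    (hB : Literature.Analysis.FluidPDE.IsBoundedAncientMildSolution 1 v)
    (hm : ∀ t < 0, AEStronglyMeasurable (v t) volume)
    (hsm : ContDiffOn ℝ (⊤ : ℕ∞) (Function.uncurry v) (Set.Iio 0 ×ˢ Set.univ))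
    {l : ℕ} {P : MvPolynomial (Fin 3) ℝ} (hl : 2 ≤ l) (hev : Even l) (hP : P.IsHomogeneous l) (hP0 : P ≠ 0)
    (hharm : ∀ y : EuclideanSpace ℝ (Fin 3),
      Laplacian.laplacian (fun z : EuclideanSpace ℝ (Fin 3) => MvPolynomial.eval (fun i => z i) P) y = 0)
    (hrep : ∀ t < 0, ∃ (g : ℝ → ℝ) (φ : EuclideanSpace ℝ (Fin 3) → ℝ), ∀ x,
      v t x = gradient φ x + (g ‖x - x₀‖ * MvPolynomial.eval (fun i => (x - x₀) i) P) • (x - x₀)) :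
    ∀ t < 0, ∀ x, curl (v t) (x₀ + x₀ - x) = curl (v t) x := by
  intro t ht x
  obtain ⟨ĝ, -, hĝ⟩ := singleDegree_vorticity_structure v x₀ hB hm hsm hl hP hP0 hharm hrep t ht
  by_cases hx : x = x₀
  · subst hx; rw [add_sub_cancel_right]
  have hx' : x₀ + x₀ - x ≠ x₀ := by
    intro h
    apply hx
    have h2 : x₀ + x₀ = x₀ + x := sub_eq_iff_eq_add.1 h
    exact (add_left_cancel h2).symm
  rw [hĝ x hx, hĝ _ hx']
  have e1 : x₀ + x₀ - x - x₀ = -(x - x₀) := by abel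
  rw [e1, norm_neg, crossGradient_neg_of_even hP hev]

/-- ★ **THE EVEN-DEGREE RUNG, PARITY REDUCTION.**  Under the hypotheses of `StubSingleDegreeRung` with a non-zero profile of EVEN degree
`l ≥ 2`, at every `t < 0`: (i) the velocity is odd about `x₀` up to the constant `2 v(t, x₀)`, `v t (x₀ + x₀ − y) = v t x₀ + v t x₀ − v t y`;
(ii) the vorticity has no drift along the centre velocity, `D(curl (v t))(x)[v t x₀] = 0` for all `x`.  (A reduction only — see the module
docstring; the even rung itself stays open.) [folklore] -/
theorem singleDegreeRung_even_parity
    (v : ℝ → EuclideanSpace ℝ (Fin 3) → EuclideanSpace ℝ (Fin 3)) (x₀ : EuclideanSpace ℝ (Fin 3))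
    (hB : Literature.Analysis.FluidPDE.IsBoundedAncientMildSolution 1 v)
    (hm : ∀ t < 0, AEStronglyMeasurable (v t) volume)
    (hsm : ContDiffOn ℝ (⊤ : ℕ∞) (Function.uncurry v) (Set.Iio 0 ×ˢ Set.univ))
    {l : ℕ} {P : MvPolynomial (Fin 3) ℝ} (hl : 2 ≤ l) (hev : Even l) (hP : P.IsHomogeneous l) (hP0 : P ≠ 0)
    (hharm : ∀ y : EuclideanSpace ℝ (Fin 3),
      Laplacian.laplacian (fun z : EuclideanSpace ℝ (Fin 3) => MvPolynomial.eval (fun i => z i) P) y = 0)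
    (hrep : ∀ t < 0, ∃ (g : ℝ → ℝ) (φ : EuclideanSpace ℝ (Fin 3) → ℝ), ∀ x,
      v t x = gradient φ x + (g ‖x - x₀‖ * MvPolynomial.eval (fun i => (x - x₀) i) P) • (x - x₀)) :
    ∀ t < 0, (∀ y, v t (x₀ + x₀ - y) = v t x₀ + v t x₀ - v t y) ∧
      ∀ x, fderiv ℝ (curl (v t)) x (v t x₀) = 0 := by
  have hcurlev : ∀ t < 0, ∀ x, curl (v t) (x₀ + x₀ - x) = curl (v t) x :=
    curl_reflect_of_even v x₀ hB hm hsm hl hev hP hP0 hharm hrep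
  have hsm' : IsSmoothSpaceTimeOn (Iio 0) v := hsm
  obtain ⟨M, hM⟩ := hB.isBoundedOn
  have hrefl : ∀ t < 0, ∀ y, v t (x₀ + x₀ - y) = (v t x₀ + v t x₀) - v t y := by
    intro t ht y
    have hvt : ContDiff ℝ ∞ (v t) := hsm'.contDiff_slice ht
    have hv2 : ContDiff ℝ 2 (v t) := hvt.of_le (by norm_cast)
    have hv1 : ContDiff ℝ 1 (v t) := hvt.of_le (by norm_cast)
    have hdiv : VectorCalculus.IsDivFree (v t) := (hB.isAncientMildSolution.1 t ht).isDivFree_of_contDiff hv1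
    have h := reflect_eq_of_curl_even hv2 hdiv (fun y => hM t ht y) (x₀ + x₀) (hcurlev t ht) y x₀
    rw [add_sub_cancel_right] at h
    rw [← h, add_sub_cancel_right]
  obtain ⟨hV, -, -⟩ := PoloidalLiouville.vorticityOfClass v hB hm hsm
  intro t ht
  refine ⟨hrefl t ht, fun x => ?_⟩
  have h := fderiv_vorticity_apply_eq_zero_of_curl_even hV (x₀ + x₀) (fun s => v s x₀ + v s x₀) hrefl hcurlev ht x
  rw [vorticity_apply, map_add] at h
  have h2 : (2 : ℝ) • fderiv ℝ (curl (v t)) x (v t x₀) = 0 := by rw [two_smul]; exact h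
  exact (smul_eq_zero.1 h2).resolve_left two_ne_zero

end Summit.NavierStokesRegularity.NavierStokesRegularity.Theorems.PoloidalLiouville.Antidynamo

end
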